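import Summits.BirchSwinnertonDyer.BirchSwinnertonDyer.Theorems.PrintX10bBeyondCarrierOfMuPartStabilizedCoherentPair
import Summits.BirchSwinnertonDyer.BirchSwinnertonDyer.Theorems.PrintX10bBeyondCarrierUpperLinkHalvesOfLevel
import Summits.BirchSwinnertonDyer.BirchSwinnertonDyer.Theorems.PrintX9StabilizedClassOfKolyvaginSystemLeaf
import Literature.NumberTheory.EllipticCurves.AnticyclotomicTowerSharpProofs
import HarnessLib

/-!
# Crux `BeyondCarrierDepthX10b` (stmt-BirchSwinnertonDyer-23055, PrintX10b aside r301), line «twins» — CENSUS OF RECORD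
# re-cut: the crux BY NAME from ELEVEN cite-only print facts (was fourteen, p681886)

HONEST FRAMING (cell `run/shared/lean/pub/bsd-print-x9/`, seat bsd-line-x10b-p1 LEAD g11, registered line «twins», skeleton v8
`Cruxes/BeyondCarrierDepthX10b/Lines/twins.lean` sha d9aa95dab226; D-0154 KEY row 10): THEOREMS ONLY, conditional glue
`--supports 23055`; nothing booked, nothing closed. «beyond-print theorem»: NO. BSD is not proved by any of this; no summit
statement is proved by this seat.

WHY. The census of record p681886 `beyondCarrierDepthX10b_of_printLeaves` hangs the crux on FOURTEEN cite-only print facts. Three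
of them are not load-bearing any more:
* `hC` (Carayol, newform level = conductor) is IDLE on the 23055 cone (finding «hC-IDLE», x10b-p1-w8 g9, 2026-08-29): it was used
  once, to learn `N = N_E` for a parametrisation datum whose level the crux already pins (`Dt : ModularParametrizationData W
  (W.conductorNorm ℤ)`); the hC-free pinned transfer is p686788
  `CompositeTransferX10b.imcWaldspurgerOnTreeGoodAt_inducedPlace_of_printFacts_of_pinnedTransfer_of_level`, fed `rfl`.
* `hCG` (Greenberg LNM 1716 Prop. 2.4, Kummer image = strict condition at good ordinary `v ∣ p`) is DISCHARGED on the μ-frames in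
  the kernel (CG-FRAME, 2026-08-29: `HeegnerMuPartControlGlue.kummerStrictOnFrames_holds`, consumed by p686226 / p689159).
* `hNV` (CGLS Thm. 4.1.1 in its torsion typing `thm411_torsionFree_heegnerClass_ne_bot_quotient_isTorsion`) is ELIMINABLE (finding
  «hNV-ELIMINABLE», x9-p1 LEAD g7, p689159 `Theorems/PrintX9StabilizedClassOfKolyvaginSystemLeaf.lean`): its ONE use on the cone
  (p631498 §1: `𝔖 ⧸ Λκ_∞(C)` is `Λ`-torsion at the letter's coherent datum `C`) follows from the OTHER Thm-4.1.1 leaf `h411`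
  (Kolyvagin-system typing, F-411) together with `h161` (Howard Thm. 1.6.1, F-161) and `Λ`-rank one of `𝔖` — which CGLS Thm. 4.1.3
  (`hCGLS`, clause (i)) supplies at `(D, C, X)`: p689159 §2
  `HeegnerStabilizedOfKSLeaf.exists_coherentPair_isTorsion_muIneq_of_howard_kolyvaginSystem h161 h411` is the coherent-pair
  μ-letter WITH its torsion clause and its μ-inequality both conditional only on `Module.Finite 𝔖`, `finrank 𝔖 = 1` (and
  `Module.Finite 𝒳` for the inequality).
So the `3 ∣ h_K` half U₃ of the cone is re-run here from `hCGLS h57 h59gp h422 h513 h331 h161 h411` (no `hNV`, no `hC`, no letter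
hypothesis, Tower♯ := the kernel theorem `anticyclotomicTowerSharp`), the `3 ∤ h_K` half from `h46 h57 h59gp h422 h513 h331` (no
`hC`), and the glue p609388 `stub_beyondCarrier_of_upperLink_of_namedFacts h331 hChaL hKo` is unchanged.
CENSUS after this file (numbers): crux 23055 BY NAME ⟸ **11 cite-only print facts** — MZ26 Cor. 4.6 (`h46`, `3 ∤ h_K` frames) ·
CGLS Thm. 4.1.3 localized (`hCGLS`) · Castella/Yan–Zhu Thm. 5.7 (1) (`h57`) · the pinned (T2)-general Heegner⟷BDP transfer at `s = 1`
(`h59gp`, inline) · BCS Prop. 4.2.2 (`h422`) · CGLS Thm. 5.1.3 (`h513`) · JSW Thm. 3.3.1 (`h331`) · Cha Rmk. 25 (`hChaL`) · Kolyvagin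
Thm. A (`hKo`) · Howard Thm. 1.6.1 (`h161`) · CGLS Thm. 4.1.1 Kolyvagin-system form (`h411`); 0 research statements, 0 classical
stubs. The binders of §2 are byte-identical to p681886's minus `hNV`, `hC`, `hCG`.

WHAT.
* (imported) `UpperHalf.upperLinkX10b_coprimeClassNumber_of_pinnedPrintFacts_of_level (h46 h57 h59gp h422 h513 h331)` — U₃ on
  the `3 ∤ h_K` frames without `hC` (x10b-p1-w8 g9, p690032 `PrintX10bBeyondCarrierUpperLinkHalvesOfLevel.lean`).
* §1 `HowardFrames.upperLinkX10b_divisibleClassNumber_of_howard_kolyvaginSystem_of_printFacts (hCGLS h57 h59gp h422 h513 h331 h161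
  h411)` — U₃ on the `3 ∣ h_K` frames; p631498 §1 with `(C, F, envelopes, torsion, μ-inequality)` taken from p689159 §2.
* §2 **`HowardFrames.beyondCarrierDepthX10b_of_elevenPrintLeaves (h46 hCGLS h57 h59gp h422 h513 h331 hChaL hKo h161 h411) :
  BeyondCarrierDepthX10b`** — THE CENSUS OF RECORD.

References: [MastellaZerman2026] Cor. 4.6; [CastellaGrossiLeeSkinner2022] Thm. 4.1.1, Rem. 4.1.4, Thm. 4.1.3, Cor. 3.4.2, Thm. 5.1.3;
[Howard2004HeegnerKolyvagin] Thm. 1.6.1, Thm. 2.2.10 (proof), §3.3; [YanZhu2024MainConjNonCM] Thm. 5.7 (1), 5.9;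
[BurungaleCastellaSkinner2025] Prop. 4.2.2; [JetchevSkinnerWan2017] Thm. 3.3.1; [Cha2005] Rmk. 25; [Kolyvagin1990] Thm. A;
[Castella2018] §5; [LombardoTronto2022] Prop. 3.12; [PerrinRiou1987BSMF] §3; companions p631498, p609477, p609388, p686788, p689159, p690032 (w8 g9's hC-free halves; its
`beyondCarrierDepthX10b_of_twelvePrintLeaves` is the twelve-leaf form), p681041 (`AnticyclotomicTowerSharpProofs`).
-/

-- the REGISTERED stub namespace `Summit.BirchSwinnertonDyer.BirchSwinnertonDyer.Cruxes.…` repeats the summit name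
set_option linter.dupNamespace false
set_option autoImplicit false

noncomputable section

open scoped Classical Pointwise

open WeierstrassCurve NumberField IsDedekindDomain Field Literature.NumberTheory.EllipticCurves
  Literature.NumberTheory.EllipticCurves.ModularForms Literature.NumberTheory.EllipticCurves.Rank1Residual
  Literature.NumberTheory.EllipticCurves.Castella2018 Literature.NumberTheory.EllipticCurves.YanZhu2026
  Literature.NumberTheory.EllipticCurves.CastellaGrossiLeeSkinner2022
  Literature.NumberTheory.EllipticCurves.JetchevSkinnerWan2017

open Summit.BirchSwinnertonDyer.Rank1Residual
open Summit.BirchSwinnertonDyer.BirchSwinnertonDyer.Rank1Residual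
  (X10.thm413Hypotheses_of_classX10)
open Summit.BirchSwinnertonDyer.BirchSwinnertonDyer.Cruxes.TwoSidedLinkAnyClassNumberX10b.CompositeTransferX10b
  (imcWaldspurgerOnTreeGoodAt_inducedPlace_of_printFacts_of_pinnedTransfer_of_level)
open Summit.BirchSwinnertonDyer.BirchSwinnertonDyer.Theorems.HeegnerStabilizedOfKSLeaf
  (exists_coherentPair_isTorsion_muIneq_of_howard_kolyvaginSystem)
open Summit.BirchSwinnertonDyer.BirchSwinnertonDyer.Theses.PrintX10b (BeyondCarrierDepthX10b)

/-! ## §1 The `3 ∣ h_K` half of U₃ from Howard Thm. 1.6.1 + CGLS Thm. 4.1.1 (KS form), no `hNV`, no `hC`, no letter hypothesis -/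

namespace Summit.BirchSwinnertonDyer.BirchSwinnertonDyer.Cruxes.BeyondCarrierDepthX10b.HowardFrames

open Summit.BirchSwinnertonDyer.BirchSwinnertonDyer.Cruxes.BeyondCarrierDepthX10b.UpperHalf
  (upperLink_of_imcWaldspurgerOnTreeGoodAt upperLinkX10b_coprimeClassNumber_of_pinnedPrintFacts_of_level)

/-- **U₃ on the `3 ∣ h_K` X10b frames from Howard Thm. 1.6.1 (`h161`) and CGLS Thm. 4.1.1 in Kolyvagin-system form (`h411`), modulo
six further print facts** (`hCGLS` CGLS Thm. 4.1.3 localized; `h57 h59gp h422 h513 h331` the pinned class-number-free transfer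
inputs) — twin of p631498 `upperLinkX10b_divisibleClassNumber_of_muPartStabilizedCoherentPair_of_printFacts` with `hNV`, `hC`,
`hTw` and the letter hypothesis `hμ` REMOVED. Chain: `jbar := IsAlgClosed.lift` along `ιC`; data `D`, `X` by the tree's existence
theorems; the printed hypotheses discharged on the frame; the tower clause `K_k ⊆ K[p^{k+1}]` is the kernel theorem
`anticyclotomicTowerSharp`; `(C, F)` on `(Dt, H.β)` with `ℋ_∞(F) ≤ Λκ_∞(C)`, `g • Λκ_∞(C) ≤ ℋ_∞(F)`, the TORSION of `𝔖/Λκ_∞(C)` and the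
μ-inequality at THAT `C` — all from p689159 §2 `exists_coherentPair_isTorsion_muIneq_of_howard_kolyvaginSystem h161 h411`, whose
rank-one premisses `Module.Finite 𝔖`, `finrank 𝔖 = 1` (and `Module.Finite 𝒳`) are CGLS Thm. 4.1.3 (i) at `(D, C, X)` (`hCGLS`);
torsion of `𝔖/ℋ_∞(F)`; promotion `I(Λκ_∞(C))² ⊆ char_Λ(𝒳_tors)`; `I(ℋ_∞(F)) ⊆ I(Λκ_∞(C))`; pinned transfer at the pinned level
(p686788, `rfl`); `≤` half.
[cite: Howard2004HeegnerKolyvagin, Thm. 1.6.1, Thm. 2.2.10 (proof) and §3.3]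
[cite: CastellaGrossiLeeSkinner2022, Thm. 4.1.1, Rem. 4.1.4, Thm. 4.1.3 and Cor. 3.4.2] [cite: Washington1997, §13.2]
[cite: YanZhu2024MainConjNonCM, Thm. 5.7 (1) and Thm. 5.9] [cite: BurungaleCastellaSkinner2025, Prop. 4.2.2]
[cite: JetchevSkinnerWan2017, Thm. 3.3.1] [cite: Castella2018, §5 (eq:IMC+BDP)] [cite: LombardoTronto2022, Prop. 3.12]
[cite: Cox2013, §7.D Thm. 7.24 and §11.A Thm. 11.1] [cite: PerrinRiou1987BSMF, §3.2] -/
theorem upperLinkX10b_divisibleClassNumber_of_howard_kolyvaginSystem_of_printFacts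
    (hCGLS : thm413_rankOne_charIdeal_torsion_dvd_localized.{0})
    (h57 : thm57_isTorsion_charIdealXGr_eq_bdpLFunction)
    (h59gp : ∀ {p : ℕ} [Fact p.Prime] (ι' : PadicAlgCl p ≃+* ℂ) (W : WeierstrassCurve ℚ) [W.IsElliptic]
      [W.IsGloballyMinimal] (K : Type) [Field K] [NumberField K] (v vbar : HeightOneSpectrum (𝓞 K))
      (κ : ZpExtension K p) (γ : absoluteGaloisGroup K) [Fact (κ.IsTopGenerator γ)] {N : ℕ} [NeZero N]
      {f : CuspForm (CongruenceSubgroup.Gamma0 N) 2} (jbar : AlgebraicClosure K →+* ℂ)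
      (_ : IsNewformOf W f),
      N = W.conductorNorm ℤ → 3 ≤ p → GoodOrd W p → (W.baseChange K).HasIrreducibleModPGaloisRep p →
      IsImaginaryQuadratic K → SatisfiesHeegnerHypothesis N K →
        ((Ideal.span {(p : ℤ)}).primesOver (𝓞 K)).ncard = 2 →
        Odd (NumberField.discr K) → NumberField.discr K ≠ -3 → κ.IsAnticyclotomic →
      (∀ (w : InfinitePlace K) (k : 𝓞 K), k ∈ v.asIdeal ↔ ‖ι'.symm (w.embedding (k : K))‖ < 1) →
        ((p : ℕ) : 𝓞 K) ∈ vbar.asIdeal → vbar ≠ v →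
      ∃ (ΩK : ℂ) (Ωp : (unrIntegers p)ˣ) (L : UnrSeries p),
        ΩK ≠ 0 ∧ IsBDPLFunction ι' v κ γ f ΩK ((Ωp : unrIntegers p) : ℂ_[p]) L ∧
        ∀ (D : (W.baseChange K).LambdaAdicSelmerData κ γ) (F : HeegnerFamily N W K κ jbar)
          (X : (W.baseChange K).SelmerDualData κ γ) (j : ℤ_[p] →+* unrIntegers p),
          ¬ (p : ℤ) ∣ F.Dt.c →
          (∀ x : ℤ_[p], ((j x : unrIntegers p) : ℂ_[p]) = algebraMap ℚ_[p] ℂ_[p] (x : ℚ_[p])) →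
          heegnerCharIdeal D F ^ 2 ≤
              Module.charIdeal (IwasawaAlgebra p) (Submodule.torsion (IwasawaAlgebra p) X.X) →
            L ∈ (AcSelmer.XAc.charIdeal (W.baseChange K) p κ vbar ∅ γ).map (PowerSeries.map j))
    (h422 : BurungaleCastellaSkinner2025.prop422_exists_isBDPLFunction_mu_eq_zero)
    (h513 : thm513_exists_isBDPLFunction_valueAtOne_disc)
    (h331 : thm331_anticyclotomicControl)
    (h161 : Literature.NumberTheory.GaloisCohomology.Howard2004.thm161_dvrKolyvaginBound)
    (h411 : CastellaGrossiLeeSkinner2022.thm411_exists_kolyvaginSystem_one_ne_zero) :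
    ∀ (W : WeierstrassCurve ℚ) [W.IsElliptic] [W.IsGloballyMinimal] (p : ℕ) [Fact p.Prime]
    [NeZero (W.conductorNorm ℤ)] (K : Type) [Field K] [NumberField K],
    Literature.NumberTheory.EllipticCurves.Rank1Residual.ClassX10 W p →
    ¬ Literature.NumberTheory.EllipticCurves.Rank1Residual.Surj W 3 → ¬ W.HasCM →
    Literature.NumberTheory.EllipticCurves.IsImaginaryQuadratic K → Odd (NumberField.discr K) →
    NumberField.discr K ≠ -3 →
    Literature.NumberTheory.EllipticCurves.SatisfiesHeegnerHypothesis (W.conductorNorm ℤ) K →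
    Literature.NumberTheory.EllipticCurves.SatisfiesHeegnerHypothesis p K →
    p ∣ NumberField.classNumber K →
    (W.baseChange K).HasIrreducibleModPGaloisRep p →
    ∀ (ι : K →+* ℚ_[p]) (κ : Literature.NumberTheory.EllipticCurves.ZpExtension K p), κ.IsAnticyclotomic →
    ∀ (γ : Field.absoluteGaloisGroup K) [Fact (κ.IsTopGenerator γ)]
    (Dt : Literature.NumberTheory.EllipticCurves.ModularForms.ModularParametrizationData W
    (W.conductorNorm ℤ)), ¬ (p : ℤ) ∣ Dt.c →
    ∀ (H : Literature.NumberTheory.EllipticCurves.HeegnerDatum (W.conductorNorm ℤ) (NumberField.discr K))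
    (ιC : K →+* ℂ) (P : (W.baseChange K).toAffine.Point),
    WeierstrassCurve.Affine.Point.map ιC.toRatAlgHom P =
    Literature.NumberTheory.EllipticCurves.ModularForms.heegnerPointComplex Dt H →
    (W.baseChange K).mordellWeilRank = 1 →
    Finite (AddCommGroup.primaryComponent (W.baseChange K).sha p) → ¬ IsOfFinAddOrder P →
    ∃ n : ℕ, Summit.BirchSwinnertonDyer.Rank1Residual.X11b.AcSelmer.XAc.HasCharValuationAt
    (W.baseChange K) p κ (Summit.BirchSwinnertonDyer.Rank1Residual.X11b.inducedPlace ι) ∅ γ n ∧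
    (n : ℤ) ≤ 2 * (Summit.BirchSwinnertonDyer.Rank1Residual.X11b.padicLogOrd W p ι P +
    (padicValInt p (1 - W.frobeniusTrace p + p) : ℤ) - 1) := by
  intro W _ _ p _ _ K _ _ hX hns hcm hK hodd h3 hHN hHp hhK hirr ι κ hκ γ _ Dt hc H ιC P hP hrk hfin hPinf
  have hγ : κ.IsTopGenerator γ := Fact.out
  have hp : p.Prime := Fact.out
  have hp_odd : Odd p := hp.odd_of_ne_two hX.ne_two
  -- an embedding `K̄ → ℂ` over `ιC` for the tied family
  letI : Algebra K ℂ := ιC.toAlgebra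
  let jbar : AlgebraicClosure K →+* ℂ :=
    (IsAlgClosed.lift (R := K) (M := ℂ) (S := AlgebraicClosure K)).toRingHom
  -- the data exist (tree theorems)
  obtain ⟨D⟩ := WeierstrassCurve.LambdaAdicSelmerDataExists.nonempty_lambdaAdicSelmerData (W.baseChange K) p κ hγ
  obtain ⟨X⟩ := (W.baseChange K).nonempty_selmerDualData_holds κ γ hγ
  have hyp := X10.thm413Hypotheses_of_classX10 hX hK h3 hHN hHp hodd hκ hγ
  -- the coherent pair `(C, F)` on `(Dt, H.β)`, the TORSION of `𝔖/Λκ_∞(C)` and the μ-inequality at that `C`, all conditional only on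
  -- Λ-rank one — from Howard Thm. 1.6.1 + CGLS Thm. 4.1.1 (KS form) (p689159 §2); tower clause := `anticyclotomicTowerSharp`
  obtain ⟨C, F, -, hFDt, -, -, hfwd, ⟨g, hg, hrev⟩, htor, hineq⟩ :=
    exists_coherentPair_isTorsion_muIneq_of_howard_kolyvaginSystem h161 h411 (W.conductorNorm ℤ) W K p κ γ jbar hyp hcm
      hX.irr hirr (hX.hasPadicScalarImage_of_not_surj hns) hHp hhK (ClassX10.not_dvd_conductorNorm hX)
      (fun k ↦ anticyclotomicTowerSharp K p hp_odd hK κ hκ jbar k)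
      (card_ringClassGalOver_prime_one_of_frame hK hodd h3 hp hHp jbar) Dt H.β H.dvd_sq_sub D X
  -- CGLS Thm. 4.1.3 at `(D, C, X)`: clause (i) gives the rank-one premisses
  obtain ⟨⟨hfinS, hS1⟩, hfinX, -⟩ := hCGLS (W.conductorNorm ℤ) W K p κ γ jbar hyp D C X
  -- `𝔖/Λκ_∞(C)` torsion (DERIVED, no `hNV`), transported to `𝔖/ℋ_∞(F)` along the reverse envelope
  have htorC : Module.IsTorsion (IwasawaAlgebra p) (D.S ⧸ stabilizedHeegnerModule D C) := (htor hfinS hS1).2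
  have htorF : Module.IsTorsion (IwasawaAlgebra p) (D.S ⧸ heegnerModule D F) :=
    isTorsion_quotient_heegnerModule_of_smul_stabilizedHeegnerModule_le D F C hg hrev htorC
  obtain ⟨m, hm⟩ := span_pow_mul_sq_le_charIdeal_torsion_of_thm413 hCGLS hyp
    (X9.selmerCorank_eq_one_of_rank_one hrk hfin) D C X
  haveI := hfinX
  haveI := hfinS
  haveI : IsNoetherian (IwasawaAlgebra p) X.X := isNoetherian_of_isNoetherianRing_of_finite _ _
  haveI : Module.Finite (IwasawaAlgebra p) (Submodule.torsion (IwasawaAlgebra p) X.X) := inferInstance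
  haveI : Module.Finite (IwasawaAlgebra p) (D.S ⧸ stabilizedHeegnerModule D C) := inferInstance
  -- the μ-part IN THE STABILISED CURRENCY at the pair's own `C`: promotion
  have hleC : stabilizedHeegnerCharIdeal D C ^ 2 ≤
      Module.charIdeal (IwasawaAlgebra p) (Submodule.torsion (IwasawaAlgebra p) X.X) :=
    IwasawaAlgebra.sq_charIdeal_le_charIdeal_of_span_p_pow_mul_le_of_lengthAt_le_two_mul
      (Submodule.torsion_isTorsion (R := IwasawaAlgebra p) (M := X.X)) htorC (hineq hfinS hfinX hS1) hm
  -- the forward envelope LAST: `I(ℋ_∞(F)) ⊆ I(Λκ_∞(C))`, so the TIED containment holds for `F`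
  have hle : heegnerCharIdeal D F ^ 2 ≤
      Module.charIdeal (IwasawaAlgebra p) (Submodule.torsion (IwasawaAlgebra p) X.X) :=
    (Ideal.pow_right_mono (heegnerCharIdeal_le_stabilizedHeegnerCharIdeal_of_le D F C htorF hfwd) 2).trans hleC
  -- the pinned class-number-free transfer at the pinned level (`rfl`), then the `≤` half
  obtain ⟨hp3, hord, -, -⟩ := id hX
  subst hp3
  exact upperLink_of_imcWaldspurgerOnTreeGoodAt
    (imcWaldspurgerOnTreeGoodAt_inducedPlace_of_printFacts_of_pinnedTransfer_of_level h57 h59gp h422 h513 h331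
      le_rfl hord hK hodd h3 rfl hHN hHp hirr ι κ hκ γ Dt hc H ιC P hP hrk hfin hPinf ⟨jbar, D, F, X, hFDt, hle⟩)

/-! ## §2 The census of record: eleven cite-only print facts -/

/-- **CENSUS OF RECORD — crux `BeyondCarrierDepthX10b` (stmt-BirchSwinnertonDyer-23055) BY NAME from ELEVEN cite-only print facts,
nothing else**: `h46` MZ26 Cor. 4.6 (`3 ∤ h_K` frames) · `hCGLS` CGLS Thm. 4.1.3 · `h57` `h59gp` `h422` `h513` `h331` (pinned transfer,
JSW control) · `hChaL` Cha Rmk. 25 · `hKo` Kolyvagin Thm. A · `h161` Howard Thm. 1.6.1 · `h411` CGLS Thm. 4.1.1 (Kolyvagin-system form).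
Relative to p681886 (fourteen leaves): `hC` dropped (idle; pinned level, p686788), `hCG` dropped (Greenberg Prop. 2.4 discharged on the
frames in the kernel, `kummerStrictOnFrames_holds`), `hNV` dropped (CGLS 4.1.1 torsion typing derived from `h411` + `h161` + rank one,
p689159); the remaining binders are byte-identical. Coprime half p690032 (w8 g9), divisible half §1, glue p609388
`stub_beyondCarrier_of_upperLink_of_namedFacts`. What is NOT proved: any of the eleven leaves; the crux unconditionally; BSD.
CONDITIONAL; credits nothing. [cite: MastellaZerman2026, Cor. 4.6] [cite: CastellaGrossiLeeSkinner2022, Thm. 4.1.1, Thm. 4.1.3 and Thm. 5.1.3]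
[cite: Howard2004HeegnerKolyvagin, Thm. 1.6.1 and Thm. 2.2.10 (proof)] [cite: YanZhu2024MainConjNonCM, Thm. 5.7 (1), 5.9]
[cite: BurungaleCastellaSkinner2025, Prop. 4.2.2] [cite: JetchevSkinnerWan2017, Thm. 3.3.1] [cite: Cha2005, Rmk. 25]
[cite: Kolyvagin1990, Thm. A] [cite: Cox2013, §7.D Thm. 7.24 and §11.A Thm. 11.1] [cite: PerrinRiou1987BSMF, §3.2] -/
theorem beyondCarrierDepthX10b_of_elevenPrintLeaves
    (h46 : MastellaZerman2026.cor46_howardDivisibility_of_scalarImage.{0})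
    (hCGLS : thm413_rankOne_charIdeal_torsion_dvd_localized.{0})
    (h57 : thm57_isTorsion_charIdealXGr_eq_bdpLFunction)
    (h59gp : ∀ {p : ℕ} [Fact p.Prime] (ι' : PadicAlgCl p ≃+* ℂ) (W : WeierstrassCurve ℚ) [W.IsElliptic]
      [W.IsGloballyMinimal] (K : Type) [Field K] [NumberField K] (v vbar : HeightOneSpectrum (𝓞 K))
      (κ : ZpExtension K p) (γ : absoluteGaloisGroup K) [Fact (κ.IsTopGenerator γ)] {N : ℕ} [NeZero N]
      {f : CuspForm (CongruenceSubgroup.Gamma0 N) 2} (jbar : AlgebraicClosure K →+* ℂ)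
      (_ : IsNewformOf W f),
      N = W.conductorNorm ℤ → 3 ≤ p → GoodOrd W p → (W.baseChange K).HasIrreducibleModPGaloisRep p →
      IsImaginaryQuadratic K → SatisfiesHeegnerHypothesis N K →
        ((Ideal.span {(p : ℤ)}).primesOver (𝓞 K)).ncard = 2 →
        Odd (NumberField.discr K) → NumberField.discr K ≠ -3 → κ.IsAnticyclotomic →
      (∀ (w : InfinitePlace K) (k : 𝓞 K), k ∈ v.asIdeal ↔ ‖ι'.symm (w.embedding (k : K))‖ < 1) →
        ((p : ℕ) : 𝓞 K) ∈ vbar.asIdeal → vbar ≠ v →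
      ∃ (ΩK : ℂ) (Ωp : (unrIntegers p)ˣ) (L : UnrSeries p),
        ΩK ≠ 0 ∧ IsBDPLFunction ι' v κ γ f ΩK ((Ωp : unrIntegers p) : ℂ_[p]) L ∧
        ∀ (D : (W.baseChange K).LambdaAdicSelmerData κ γ) (F : HeegnerFamily N W K κ jbar)
          (X : (W.baseChange K).SelmerDualData κ γ) (j : ℤ_[p] →+* unrIntegers p),
          ¬ (p : ℤ) ∣ F.Dt.c →
          (∀ x : ℤ_[p], ((j x : unrIntegers p) : ℂ_[p]) = algebraMap ℚ_[p] ℂ_[p] (x : ℚ_[p])) →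
          heegnerCharIdeal D F ^ 2 ≤
              Module.charIdeal (IwasawaAlgebra p) (Submodule.torsion (IwasawaAlgebra p) X.X) →
            L ∈ (AcSelmer.XAc.charIdeal (W.baseChange K) p κ vbar ∅ γ).map (PowerSeries.map j))
    (h422 : BurungaleCastellaSkinner2025.prop422_exists_isBDPLFunction_mu_eq_zero)
    (h513 : thm513_exists_isBDPLFunction_valueAtOne_disc)
    (h331 : thm331_anticyclotomicControl)
    (hChaL : Cha2005.rmk25_pow_dvd_card_sha_primary_of_certificate)
    (hKo : ∀ (N : ℕ) [NeZero N] (W : WeierstrassCurve ℚ) (K : Type) [Field K] [NumberField K],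
      kolyvagin N W K)
    (h161 : Literature.NumberTheory.GaloisCohomology.Howard2004.thm161_dvrKolyvaginBound)
    (h411 : CastellaGrossiLeeSkinner2022.thm411_exists_kolyvaginSystem_one_ne_zero) :
    BeyondCarrierDepthX10b := by
  refine stub_beyondCarrier_of_upperLink_of_namedFacts h331 hChaL hKo ?_
  intro W _ _ p _ _ K _ _ hX hns hcm hK hodd h3 hHN hHp hirr ι κ hκ γ _ Dt hc H ιC P hP hrk hfin hPinf
  by_cases hh : p ∣ NumberField.classNumber K
  · exact upperLinkX10b_divisibleClassNumber_of_howard_kolyvaginSystem_of_printFacts hCGLS h57 h59gp h422 h513 h331 h161 h411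
      W p K hX hns hcm hK hodd h3 hHN hHp hh hirr ι κ hκ γ Dt hc H ιC P hP hrk hfin hPinf
  · exact upperLinkX10b_coprimeClassNumber_of_pinnedPrintFacts_of_level h46 h57 h59gp h422 h513 h331 W p K hX hns
      hcm hK hodd h3 hHN hHp hirr hh ι κ hκ γ Dt hc H ιC P hP hrk hfin hPinf

end Summit.BirchSwinnertonDyer.BirchSwinnertonDyer.Cruxes.BeyondCarrierDepthX10b.HowardFrames

end
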